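import Summits.MatrixMultiplication.MatrixMultiplication.Theorems.SaturationLadderLevelTwoK10Word
import Literature.Computability.AlgebraicComplexity.RectangularExponentAlpha
import HarnessLib

/-!
# Level 2 of the saturation ladder at `ω(1,10,1)`: `ω(1,10,1) ≤ 412/37 = 11.135135…`
# (route `SaturationLadder`, node `TailDescentTwo`, lens 1 «grading / quantitative ladder», gen 22)

Cell `decomp-mm`, lens 1, gen 22 — the FAR rung of the level-2 DEFECT LADDER
`δ_k = ω(1,k,1) − (k+1)` in proved currency (`δ₂ ≤ 0.2581`, `δ₃ ≤ 0.2106`, `δ₄ ≤ 0.1861`,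
`δ₅ ≤ 0.1693`, `δ₆ ≤ 0.1563` in `SaturationLadderLevelTwoK2/3/4/5/6`): **`ω(1,10,1) ≤ 412/37`**,
i.e. `δ₁₀ ≤ 5/37 = 0.135135` (`omegaRect_one_ten_one_le_412_37`), beating descent from the `k = 6`
rung (`229/32 + 4 = 11.15625`), and the tail `ω(1,k,1) ≤ k + 42/37` for every real `k ≥ 10`
(`omegaRect_one_mid_one_le_add_of_ten`).  No named facts, no sorry, no definitions (design and law
in `SaturationLadderLevelTwoK10Word`, `q = 14` block lemmas and the packing bound
`R̃(CW_14^{⊗2}) ≤ 256` in `SaturationLadderLevelTwoKit14`).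

THE PROOF.  `laserMethod_hasFormatValue_of_wordValue` on the valued word `lvl2Word` (`d = 2486`,
`q = 14`, `71` copies of the `3 : 3 : 2` family block at `σ = 19/20`, NO letter `400`); the law is
of product form on the used support with empty row `I = 4`, so the penalty is `0` (zero-row lemma);
marginals `x : (1872, 430, 182, 2, 0)/2486`, `y = z : (24, 466, 1883, 112, 1)/2486`, `H_y ≤ H_x`
(`cert_marginals`); formats `A^{10} ≤ B` by `cert_format : 14^31453 ≤ 28^1900 · 198^14500`; packing
`2^{H_y} W A^{ω(1,10,1)} ≤ 256` and the final integer certificate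
`cert_final : 2^507622 · 233^17242 · 269^69671 ≤ 3^15592 · 7^73681 · 11^100222 · 113^91982`
(prime logarithms `ln 2486 = ln 2 + ln 11 + ln 113`, `ln 24`, `ln 466 = ln 2 + ln 233`,
`ln 1883 = ln 7 + ln 269`, `ln 112`, `ln 28`, `ln 198 = ln 2 + 2 ln 3 + ln 11`, `ln 14`, `ln 256`).
WHY `q = 14`: the cap `A^{10} ≤ B` of the kernel is infeasible at its free optimum for `q ≤ 12`
(`ln B / ln A = 7.93, 8.70, 9.48` at `q = 10, 11, 12`); capped optima `11.13392 (q = 13)`,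
`11.13320 (q = 14)`, `11.13444 (q = 15)` — numerics gen22/design332.py, intsearch332.py,
certs_gen.py: integer design `11.1343670`, `ln B / ln A = 10.00046`, slack to `412/37`: `7.7e-4`,
log-margin of `cert_final`: `29.9`.  All certificates are `decide`d integer inequalities (kernel;
`exponentiation.threshold 10⁶`).

## References

* F. Le Gall, *Faster algorithms for rectangular matrix multiplication*, FOCS 2012,
  arXiv:1204.1111, §3, §6.1, Prop. 6.2, Table 2. [LeGall2012]
* D. Coppersmith, S. Winograd, *Matrix multiplication via arithmetic progressions*,
  J. Symbolic Comput. 9 (1990), §8. [CoppersmithWinograd1990]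
* D. Coppersmith, *Rectangular matrix multiplication revisited*, J. Complexity 13 (1997), §3.
  [Coppersmith1997]
* F. Le Gall, *Powers of tensors and fast matrix multiplication*, ISSAC 2014, arXiv:1401.7714,
  Thm. 4.1 and Appendix A.3. [LeGall2014]
* F. Le Gall, F. Urrutia, *Improved rectangular matrix multiplication using powers of the
  Coppersmith–Winograd tensor*, SODA 2018, arXiv:1708.05622, Table 3. [LeGallUrrutia2018]
-/

set_option linter.dupNamespace false
set_option autoImplicit false
set_option exponentiation.threshold 1000000
set_option maxRecDepth 100000

noncomputable section

open Finset Real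
open scoped BigOperators

namespace Summit.MatrixMultiplication.MatrixMultiplication.Theorems.SaturationLadderLevelTwoK10

open Literature.Computability.AlgebraicComplexity
open SaturationLadderLevelTwoKit (PL5 supp14)
open SaturationLadderLevelTwoKit14
open SaturationLadderLevelTwo (append_mem repWord_mem const_mem fin5_lits negMulLog_div'
  log_two_mul_shannonEntropy_fin5)

/-! ## Marginal entropies -/

/-- **`ln 2 · H_x = ln 2486 − (1872 ln 1872 + 430 ln 430 + 182 ln 182 + 2 ln 2)/2486`.**
[folklore] -/
theorem entropy₁_lvl2Law : Real.log 2 * shannonEntropy (marginalDist₁ lvl2Law) =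
    Real.log 2486 - (1872 * Real.log 1872 + 430 * Real.log 430 + 182 * Real.log 182 +
      2 * Real.log 2) / 2486 := by
  obtain ⟨e0, e1, e2, e3, e4⟩ := marginalDist₁_lvl2Law
  rw [log_two_mul_shannonEntropy_fin5, e0, e1, e2, e3, e4,
    negMulLog_div' (by norm_num) (by norm_num), negMulLog_div' (by norm_num) (by norm_num),
    negMulLog_div' (by norm_num) (by norm_num), negMulLog_div' (by norm_num) (by norm_num),
    Real.negMulLog_zero]
  ring

/-- **`ln 2 · H_y = ln 2486 − (24 ln 24 + 466 ln 466 + 1883 ln 1883 + 112 ln 112 + 1 ln 1)/2486`.**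
[folklore] -/
theorem entropy₂_lvl2Law : Real.log 2 * shannonEntropy (marginalDist₂ lvl2Law) =
    Real.log 2486 - (24 * Real.log 24 + 466 * Real.log 466 + 1883 * Real.log 1883 +
      112 * Real.log 112 + 1 * Real.log 1) / 2486 := by
  obtain ⟨e0, e1, e2, e3, e4⟩ := marginalDist₂_lvl2Law
  rw [log_two_mul_shannonEntropy_fin5, e0, e1, e2, e3, e4,
    negMulLog_div' (by norm_num) (by norm_num), negMulLog_div' (by norm_num) (by norm_num),
    negMulLog_div' (by norm_num) (by norm_num), negMulLog_div' (by norm_num) (by norm_num),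
    negMulLog_div' (by norm_num) (by norm_num)]
  ring

/-- `ln 2 · H_z = ln 2 · H_y`. [folklore] -/
theorem entropy₃_lvl2Law : Real.log 2 * shannonEntropy (marginalDist₃ lvl2Law) =
    Real.log 2486 - (24 * Real.log 24 + 466 * Real.log 466 + 1883 * Real.log 1883 +
      112 * Real.log 112 + 1 * Real.log 1) / 2486 := by
  obtain ⟨e0, e1, e2, e3, e4⟩ := marginalDist₃_lvl2Law
  rw [log_two_mul_shannonEntropy_fin5, e0, e1, e2, e3, e4,
    negMulLog_div' (by norm_num) (by norm_num), negMulLog_div' (by norm_num) (by norm_num),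
    negMulLog_div' (by norm_num) (by norm_num), negMulLog_div' (by norm_num) (by norm_num),
    negMulLog_div' (by norm_num) (by norm_num)]
  ring

/-- Integer certificate: `∏ u_x^{u_x} ≤ ∏ u_y^{u_y}` (`H_y ≤ H_x`; the factor `1^1` of `u_y`
omitted). [folklore] -/
theorem cert_marginals :
    (1872 : ℕ) ^ 1872 * 430 ^ 430 * 182 ^ 182 * 2 ^ 2 ≤
      24 ^ 24 * 466 ^ 466 * 1883 ^ 1883 * 112 ^ 112 := by
  decide

/-! ## The certificates and the conclusion -/

/-- Integer certificate: `14^31453 ≤ 28^1900 · 198^14500` (`A^{10} ≤ B` for the per-position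
formats).
[folklore] -/
theorem cert_format : (14 : ℕ) ^ 31453 ≤ 28 ^ 1900 * 198 ^ 14500 := by
  decide

/-- Integer certificate of the final inequality `37 (ln 256 − H_y ln 2 − ln W) ≤ 412 ln A`:
`2^507622 · 233^17242 · 269^69671 ≤ 3^15592 · 7^73681 · 11^100222 · 113^91982`.
[folklore] -/
theorem cert_final :
    (2 : ℕ) ^ 507622 * 233 ^ 17242 * 269 ^ 69671 ≤
      3 ^ 15592 * 7 ^ 73681 * 11 ^ 100222 * 113 ^ 91982 := by
  decide

/-- **Level 2 of the saturation ladder at `ω(1,10,1)` (the `k = 10` instance of the hypothesis of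
the node `TailDescentTwo`): `ω(1,10,1) ≤ 412/37`** (Le Gall 2012 §6 at `q = 14` in the tree's
currency,
with the `3 : 3 : 2` family block at `σ = 19/20` and the explicit design `lvl2Word`).
[cite: LeGall2012, §6.1, Prop. 6.2 and Table 2] [cite: CoppersmithWinograd1990, §8]
[cite: Coppersmith1997, §3] -/
theorem omegaRect_one_ten_one_le_412_37 : omegaRect ℂ 1 10 1 ≤ 412 / 37 := by
  -- the minimum marginal entropy is `H_y` (folded in: `H_y ≤ H_x`, `H_z = H_y`)
  have entropy₂_le_entropy₁ :
      shannonEntropy (marginalDist₂ lvl2Law) ≤ shannonEntropy (marginalDist₁ lvl2Law) := by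
    have hlog : 0 < Real.log 2 := Real.log_pos one_lt_two
    have h : ((1872 : ℕ) ^ 1872 * 430 ^ 430 * 182 ^ 182 * 2 ^ 2 : ℝ) ≤
        (24 : ℕ) ^ 24 * 466 ^ 466 * 1883 ^ 1883 * 112 ^ 112 := by
      exact_mod_cast cert_marginals
    push_cast at h
    have h' := Real.log_le_log (by positivity) h
    rw [Real.log_mul (by positivity) (by positivity), Real.log_mul (by positivity) (by positivity),
      Real.log_mul (by positivity) (by positivity), Real.log_mul (by positivity) (by positivity),
      Real.log_mul (by positivity) (by positivity), Real.log_mul (by positivity) (by positivity)]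
      at h'
    simp only [Real.log_pow, Nat.cast_ofNat] at h'
    have e1 := entropy₁_lvl2Law
    have e2 := entropy₂_lvl2Law
    have key : Real.log 2 * shannonEntropy (marginalDist₂ lvl2Law) ≤
        Real.log 2 * shannonEntropy (marginalDist₁ lvl2Law) := by
      rw [e1, e2]
      linarith [h', Real.log_one]
    exact le_of_mul_le_mul_left key hlog
  have entropy₃_eq_entropy₂ :
      shannonEntropy (marginalDist₃ lvl2Law) = shannonEntropy (marginalDist₂ lvl2Law) := by
    have hlog : Real.log 2 ≠ 0 := (Real.log_pos one_lt_two).ne'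
    have e := entropy₃_lvl2Law
    rw [← entropy₂_lvl2Law] at e
    exact mul_left_cancel₀ hlog e
  have min_entropy_lvl2Law :
      min (shannonEntropy (marginalDist₁ lvl2Law)) (min (shannonEntropy (marginalDist₂ lvl2Law))
        (shannonEntropy (marginalDist₃ lvl2Law))) = shannonEntropy (marginalDist₂ lvl2Law) := by
    rw [entropy₃_eq_entropy₂, min_self]
    exact min_eq_right entropy₂_le_entropy₁
  -- per-position value and formats: the `2486`-th roots of the totals
  set W : ℝ := Vtot ^ (((2486 : ℕ) : ℝ)⁻¹) with hWdef
  set A : ℝ := Xtot ^ (((2486 : ℕ) : ℝ)⁻¹) with hAdef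
  set B : ℝ := Ytot ^ (((2486 : ℕ) : ℝ)⁻¹) with hBdef
  have hW0 : 0 < W := Real.rpow_pos_of_pos Vtot_pos _
  have hA0 : 0 < A := Real.rpow_pos_of_pos Xtot_pos _
  have hB0 : 0 < B := Real.rpow_pos_of_pos Ytot_pos _
  have hWd : W ^ 2486 = Vtot := Real.rpow_inv_natCast_pow Vtot_pos.le (by norm_num)
  have hAd : A ^ 2486 = Xtot := Real.rpow_inv_natCast_pow Xtot_pos.le (by norm_num)
  have hBd : B ^ 2486 = Ytot := Real.rpow_inv_natCast_pow Ytot_pos.le (by norm_num)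
  have hblk : HasFormatValue (blockOf14 lvl2Word) (W ^ 2486) (A ^ 2486) (B ^ 2486) (A ^ 2486) := by
    rw [hWd, hAd, hBd]; exact hasFormatValue_lvl2Word
  -- the laser method on the valued word
  have hT := laserMethod_hasFormatValue_of_wordValue (bigCwSq ℂ 14) cwLev2 cwLev2 cwLev2
    cwSupport₂ (bigCwSq_cwSupport₂ ℂ 14) cwTight₂ cwTight₂ cwTight₂γ cwTight₂_injective
    cwTight₂_injective cwTight₂γ_injective cwTight₂_bound cwTight₂_bound cwTight₂_sum
    (by norm_num : 0 < 2486) lvl2Word lvl2Word_mem lvl2Law lvl2Law_eq hW0 hA0.le hB0.le hA0.le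
    hblk
  rw [maxEntropyPenalty_lvl2Law, sub_zero, min_entropy_lvl2Law] at hT
  -- logarithms of the roots
  have hlogW : Real.log W = (2486 : ℝ)⁻¹ * (71 * (6 * Real.log 2)) := by
    rw [hWdef, Real.log_rpow Vtot_pos, Vtot, one_mul, Real.log_pow,
      Real.log_rpow (by norm_num : (0 : ℝ) < 2)]
    push_cast; ring
  have hlogA : Real.log A = (2486 : ℝ)⁻¹ *
      (3 * Real.log 28 + 20 * Real.log 198 + 71 * (5 * Real.log 14)) := by
    rw [hAdef, Real.log_rpow Xtot_pos, Xtot, Real.log_mul (by positivity) (by positivity),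
      Real.log_mul (by positivity) (by positivity), Real.log_pow, Real.log_pow, Real.log_pow,
      Real.log_rpow (by norm_num : (0 : ℝ) < 14)]
    push_cast; ring
  have hlogB : Real.log B = (2486 : ℝ)⁻¹ *
      (220 * Real.log 28 + 1650 * Real.log 198 + 71 * (57 / 10 * Real.log 14)) := by
    rw [hBdef, Real.log_rpow Ytot_pos, Ytot, Real.log_mul (by positivity) (by positivity),
      Real.log_mul (by positivity) (by positivity), Real.log_pow, Real.log_pow, Real.log_pow,
      Real.log_rpow (by norm_num : (0 : ℝ) < 14)]
    push_cast; ring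
  have l28 : Real.log 28 = 2 * Real.log 2 + Real.log 7 := by
    rw [show (28 : ℝ) = 2 ^ 2 * 7 by norm_num, Real.log_mul (by norm_num) (by norm_num),
      Real.log_pow]; push_cast; ring
  have l198 : Real.log 198 = Real.log 2 + 2 * Real.log 3 + Real.log 11 := by
    rw [show (198 : ℝ) = 2 * 3 ^ 2 * 11 by norm_num, Real.log_mul (by norm_num) (by norm_num),
      Real.log_mul (by norm_num) (by norm_num), Real.log_pow]; push_cast; ring
  have l14 : Real.log 14 = Real.log 2 + Real.log 7 := by
    rw [show (14 : ℝ) = 2 * 7 by norm_num, Real.log_mul (by norm_num) (by norm_num)]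
  have l256 : Real.log 256 = 8 * Real.log 2 := by
    rw [show (256 : ℝ) = 2 ^ 8 by norm_num, Real.log_pow]; push_cast; ring
  have l2486 : Real.log 2486 = Real.log 2 + Real.log 11 + Real.log 113 := by
    rw [show (2486 : ℝ) = 2 * 11 * 113 by norm_num, Real.log_mul (by norm_num) (by norm_num),
      Real.log_mul (by norm_num) (by norm_num)]
  have l24 : Real.log 24 = 3 * Real.log 2 + Real.log 3 := by
    rw [show (24 : ℝ) = 2 ^ 3 * 3 by norm_num, Real.log_mul (by norm_num) (by norm_num),
      Real.log_pow]; push_cast; ring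
  have l466 : Real.log 466 = Real.log 2 + Real.log 233 := by
    rw [show (466 : ℝ) = 2 * 233 by norm_num, Real.log_mul (by norm_num) (by norm_num)]
  have l1883 : Real.log 1883 = Real.log 7 + Real.log 269 := by
    rw [show (1883 : ℝ) = 7 * 269 by norm_num, Real.log_mul (by norm_num) (by norm_num)]
  have l112 : Real.log 112 = 4 * Real.log 2 + Real.log 7 := by
    rw [show (112 : ℝ) = 2 ^ 4 * 7 by norm_num, Real.log_mul (by norm_num) (by norm_num),
      Real.log_pow]; push_cast; ring
  -- (1) `A > 1`
  have hX1 : 1 < Xtot := by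
    unfold Xtot
    have h1 : (1 : ℝ) < 28 ^ 3 * 198 ^ 20 := by norm_num
    have h2 : (1 : ℝ) ≤ ((14 : ℝ) ^ (5 : ℝ)) ^ 71 :=
      one_le_pow₀ (Real.one_le_rpow (by norm_num) (by norm_num))
    exact one_lt_mul_of_lt_of_le h1 h2
  have hA1 : 1 < A := Real.one_lt_rpow hX1 (by positivity)
  have hlA : 0 < Real.log A := Real.log_pos hA1
  -- (2) the format inequality `A^10 ≤ B`
  have hAB : A ^ (10 : ℝ) ≤ B := by
    rw [← Real.log_le_log_iff (Real.rpow_pos_of_pos hA0 _) hB0, Real.log_rpow hA0, hlogA, hlogB]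
    have hc : ((14 : ℕ) ^ 31453 : ℝ) ≤ (28 : ℕ) ^ 1900 * (198 : ℕ) ^ 14500 := by
      exact_mod_cast cert_format
    push_cast at hc
    have hc' := Real.log_le_log (by positivity) hc
    rw [Real.log_mul (by positivity) (by positivity)] at hc'
    simp only [Real.log_pow, Nat.cast_ofNat] at hc'
    linarith
  -- (3) the packing bound `2^{H_y} W A^{ω(1,10,1)} ≤ R̃(CW_14^{⊗2}) ≤ 256`, in logarithms
  have hmain := mul_rpow_omegaRect_le_asymptoticRank_of_hasFormatValue hT hA1 (by norm_num) hAB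
  have h256 := hmain.trans asymptoticRank_bigCwSq_fourteen_le
  have hpos :
      0 < (2 : ℝ) ^ shannonEntropy (marginalDist₂ lvl2Law) * W * A ^ omegaRect ℂ 1 10 1 := by
    positivity
  have hlog := Real.log_le_log hpos h256
  rw [Real.log_mul (by positivity) (by positivity), Real.log_mul (by positivity) (by positivity),
    Real.log_rpow (by norm_num : (0 : ℝ) < 2), Real.log_rpow hA0] at hlog
  -- (4) the final certificate: `ln 256 − H_y ln 2 − ln W ≤ (412/37) ln A`
  have e2 := entropy₂_lvl2Law
  rw [l2486, l24, l466, l1883, l112, Real.log_one] at e2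
  have hc : ((2 : ℕ) ^ 507622 * (233 : ℕ) ^ 17242 * (269 : ℕ) ^ 69671 : ℝ) ≤
      (3 : ℕ) ^ 15592 * (7 : ℕ) ^ 73681 * (11 : ℕ) ^ 100222 * (113 : ℕ) ^ 91982 := by
    exact_mod_cast cert_final
  push_cast at hc
  have hc' := Real.log_le_log (by positivity) hc
  rw [Real.log_mul (by positivity) (by positivity), Real.log_mul (by positivity) (by positivity),
    Real.log_mul (by positivity) (by positivity), Real.log_mul (by positivity) (by positivity),
    Real.log_mul (by positivity) (by positivity)] at hc'
  simp only [Real.log_pow, Nat.cast_ofNat] at hc'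
  have hfin : Real.log 256 - shannonEntropy (marginalDist₂ lvl2Law) * Real.log 2 - Real.log W ≤
      412 / 37 * Real.log A := by
    rw [hlogW, hlogA, l256, l28, l198, l14]
    linarith
  have key : omegaRect ℂ 1 10 1 * Real.log A ≤ 412 / 37 * Real.log A := by linarith
  exact le_of_mul_le_mul_right key hlA

/-- **`ω(1,10,1) < 11.1352`.** [cite: LeGall2012, §6.1] -/
theorem omegaRect_one_ten_one_lt_11_1352 : omegaRect ℂ 1 10 1 < 11.1352 :=
  lt_of_le_of_lt omegaRect_one_ten_one_le_412_37 (by norm_num)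

/-- **The `k = 10` rung beats descent from the `k = 6` rung** (`229/32 + 4 = 357/32 = 11.15625`,
`SaturationLadderLevelTwoK6.omegaRect_one_mid_one_le_add_of_six`). [cite: LeGall2012, §6.1] -/
theorem omegaRect_one_ten_one_lt_descent : omegaRect ℂ 1 10 1 < 357 / 32 :=
  lt_of_le_of_lt omegaRect_one_ten_one_le_412_37 (by norm_num)

/-- The remaining gap of the rung to `ω(1,10,1) = 11` (the `k = 10` instance of the hypothesis of
`TailDescentTwo`) is `< 0.1352`: the level-2 defect ladder reads `0.2581 (k=2) > 0.2106 (k=3) >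
0.1861 (k=4) > 0.1693 (k=5) > 0.1563 (k=6) > 0.1352 (k=10)`. [cite: LeGall2012, §6.1] -/
theorem omegaRect_one_ten_one_sub_eleven_lt : omegaRect ℂ 1 10 1 - 11 < 0.1352 := by
  have := omegaRect_one_ten_one_le_412_37; norm_num at this ⊢; linarith

/-- **Descent to the tail**: `ω(1,k,1) ≤ k + 42/37` for every real `k ≥ 10`
(`omegaRect_one_mid_one_le_add`). [cite: Coppersmith1997, §3] -/
theorem omegaRect_one_mid_one_le_add_of_ten (k : ℝ) (hk : 10 ≤ k) :
    omegaRect ℂ 1 k 1 ≤ k + 42 / 37 := by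
  have h := omegaRect_one_mid_one_le_add (K := ℂ) hk
  have h10 := omegaRect_one_ten_one_le_412_37
  norm_num at h h10 ⊢
  linarith

end Summit.MatrixMultiplication.MatrixMultiplication.Theorems.SaturationLadderLevelTwoK10

end
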